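import Summits.FinalStateConjecture.FinalStateConjecture.Theorems.SwallowTheDatumKerrShieldedSettlesStubKerrLeafSojournAux2
import Summits.FinalStateConjecture.FinalStateConjecture.Theorems.SwallowTheDatumKerrShieldedSettlesStubKerrLeafSojournAux3
import Summits.FinalStateConjecture.FinalStateConjecture.Theorems.StarvedNecksHonestFixedRadiusSettlingStubFarExitEscape
import Literature.Geometry.Lorentzian.NullInfinity
import HarnessLib

/-!
# `KerrShieldedSettles`, line `tapered-temporal-collar` — stub S4 `stub_kerrLeafSojourn`:
# sojourn completeness of the ingoing Kerr–Schild chart seen from the bent leaf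

Support file for crux `stmt-FinalStateConjecture-10054`
(`Summit.FinalStateConjecture.FinalStateConjecture.Theses.SwallowTheDatum.KerrShieldedSettles`): the
registered stub `stub_kerrLeafSojourn` — for sub-extremal `(M, a)`, `0 ≤ M`, `r₋ < r₁ < r₊`, the bent leaf
`ψ = graph M a r₁` and a future unit normal field `ν` of it, there is `R₀` (`= 10M`) such that for every
`s > 0` there is `R₁` (`= 21 s + 53M + |a| + 1`) such that every normalised future null ray `γ` of
`Kerr.smoothMetric M a r₁` from a leaf point of Kerr–Schild radius `≥ R₁` is future complete in the chart
(`[0, ∞) ⊆ dom`) or spends affine time `≥ s` in `J⁺(ψ{r ≤ R₀})`.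

Proof (Dafermos–Rodnianski arXiv:0811.0354, §5.1 optics of the ingoing Kerr–Schild chart, in the crude
form of the line's idea card).  Along the ray the Killing energy `E = −g(γ̇, ∂_{t*})` is conserved
(`ray_energy_eq`) and pinned by the normalisation, `0 < E ≤ 5` (`energy_pos_le_five`); on `{r ≥ 16M}`
(`H ≤ 1/16`) a null velocity with energy `E` has `0 < γ̇⁰ ≤ 4E/3 ≤ 7` and `|γ̇⃗| ≤ γ̇⁰`
(`ks_null_energy_far`), so the coordinate time is monotone, the spatial displacement is bounded by the
elapsed coordinate time, and the chart velocity is bounded.  ESCAPE: if the ray stayed in `{r ≥ 16M}` for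
all positive parameters of a bounded domain, its tangent lifts would stay in a compact subset of the
tangent bundle of the chart and the maximal geodesic would extend (`not_bddAbove_of_tangentLift_mem`);
so an incomplete ray reaches `r = 16M` at a first parameter `λ₁ > 0`, where `‖x⃗‖ ≤ 17M`.  BANKING: the
function `f = t* − 2‖x⃗‖ + 14M` is negative at the start (`T ≤ r/2 + M`, `‖y‖ ≥ 53M`) and positive at
`λ₁` (the ray gained coordinate time `≥ ‖y‖ − 17M`), so it vanishes at some `λₑ < λ₁`
(intermediate value theorem), where `‖x⃗‖ ≥ 10M`; there the ray is in the explicit region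
`{x⁰ ≥ 2‖x⃗‖ − 14M, ‖x⃗‖ ≥ 10M} ⊆ J⁺(ψ{r ≤ 10M})` (`leaf_cone_mem_causalFuture`), and `J⁺` is hereditary
along the future causal ray (`mem_causalFuture_of_le`), so the sojourn is at least
`λ₁ − λₑ ≥ f(λ₁)/21 ≥ (‖y‖ − 37M)/21 ≥ s`.

References: Dafermos–Rodnianski arXiv:0811.0354, §5.1; Christodoulou, CQG 16 (1999) A23, pp. A26–A27;
O'Neill 1983, Ch. 5, Lemma 8 (escape), Ch. 14, p. 402.
-/

set_option linter.dupNamespace false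

noncomputable section

open Set Filter MeasureTheory
open scoped Manifold ContDiff Topology
open Literature.Geometry.Lorentzian
open Summit.FinalStateConjecture.FinalStateConjecture.Theorems.KerrShieldedDataExist.Negative
  (bentHeight bentHeight_eq_literal graph coe_graph psi_eq_graph mass_pos rMinus_nonneg rPlus_le_two_mul)
open Summit.FinalStateConjecture.FinalStateConjecture.Theorems.StarvedNecks.OneOverDelta.FarEnd (ks_null_energy_far)
open Summit.FinalStateConjecture.FinalStateConjecture.Theorems.StarvedNecks.OneOverDelta.Escape (not_bddAbove_of_tangentLift_mem isCompact_setOf_tangent)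

namespace Summit.FinalStateConjecture.FinalStateConjecture.Theorems.SwallowTheDatum.KerrShieldedSettles

namespace KerrLeafSojourn

section Main

variable [Kerr.Facts] {M a r₁ : ℝ} [(Kerr.smoothMetric M a r₁).HasLeviCivita]
  {γ : ℝ → Kerr.region a r₁} {dom : Set ℝ}

/-- **Far facts along a null geodesic with energy `E ∈ (0, 5]`.** At a parameter where `r ≥ 16M`
(`H ≤ 1/16`), the chart velocity `v = γ̇` satisfies `0 < v⁰ ≤ 7` and `‖v⃗‖ ≤ v⁰`
(`ks_null_energy_far`: `3v⁰/4 ≤ E ≤ 5`). [cite: arXiv08110354, §5.1] -/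
theorem ray_far_bounds (hM : 0 ≤ M) (hopen : IsOpen dom) (hoc : dom.OrdConnected)
    (hgeo : IsGeodesicOn (Kerr.smoothMetric M a r₁).leviCivita γ dom) (h0 : (0 : ℝ) ∈ dom)
    (hnull : Kerr.bilin M a (γ 0) (deriv (fun σ ↦ (γ σ : E4)) 0) (deriv (fun σ ↦ (γ σ : E4)) 0) = 0)
    (hE : 0 < -Kerr.bilin M a (γ 0) (deriv (fun σ ↦ (γ σ : E4)) 0) (E4.basisVector 0))
    (hE5 : -Kerr.bilin M a (γ 0) (deriv (fun σ ↦ (γ σ : E4)) 0) (E4.basisVector 0) ≤ 5)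
    {t : ℝ} (ht : t ∈ dom) (hr : 16 * M ≤ Kerr.radius a (γ t)) :
    0 < deriv (fun σ ↦ (γ σ : E4)) t 0 ∧
      ‖E4.spatial (deriv (fun σ ↦ (γ σ : E4)) t)‖ ≤ deriv (fun σ ↦ (γ σ : E4)) t 0 ∧
      deriv (fun σ ↦ (γ σ : E4)) t 0 ≤ 7 := by
  have hx : 0 < Kerr.radius a (γ t) := Kerr.radius_pos_of_mem_region (γ t).2
  have hH : Kerr.scalarH M a (γ t) ≤ 1 / 16 := scalarH_le_inv hM a hx (by norm_num) hr
  have hnull' : Kerr.bilin M a (γ t) (deriv (fun σ ↦ (γ σ : E4)) t) (deriv (fun σ ↦ (γ σ : E4)) t) = 0 := by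
    rw [ray_null_eq hopen hoc hgeo ht h0, hnull]
  have hEt : -Kerr.bilin M a (γ t) (deriv (fun σ ↦ (γ σ : E4)) t) (E4.basisVector 0) =
      -Kerr.bilin M a (γ 0) (deriv (fun σ ↦ (γ σ : E4)) 0) (E4.basisVector 0) := by
    rw [ray_energy_eq hopen hoc hgeo ht h0]
  obtain ⟨hv0, hsp, h34, -⟩ := ks_null_energy_far hM hx hH hnull' (by rw [hEt]; exact hE)
  exact ⟨hv0, hsp, by linarith⟩

/-- **Escape: a ray that stays in `{r ≥ 16M}` is future complete in the chart.** If the maximal null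
geodesic `γ` (energy `E ∈ (0, 5]` at `0 ∈ dom`) has `r(γ t) ≥ 16M` for all `t ∈ dom`, `t ≥ 0`, then
`[0, ∞) ⊆ dom`: otherwise `dom` is bounded above, the coordinate curve is `14`-Lipschitz on `dom ∩ [0, ∞)`,
so the tangent lifts stay in the compact set of tangent vectors of norm `≤ 14` over
`B̄(γ 0, 14 b) ∩ {r ≥ 16M} ⊆ Kerr.region a r₁`, and the escape lemma (`not_bddAbove_of_tangentLift_mem`,
O'Neill 1983, Ch. 5, Lemma 8) contradicts maximality. [cite: ONeill1983, Ch. 5, Lemma 8] -/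
theorem Ici_subset_of_far (ha : |a| < M) (hM : 0 ≤ M) (h₂ : r₁ < Kerr.rPlus M a)
    (hmax : IsMaximalGeodesicOn (Kerr.smoothMetric M a r₁).leviCivita γ dom) (h0 : (0 : ℝ) ∈ dom)
    (hnull : Kerr.bilin M a (γ 0) (deriv (fun σ ↦ (γ σ : E4)) 0) (deriv (fun σ ↦ (γ σ : E4)) 0) = 0)
    (hE : 0 < -Kerr.bilin M a (γ 0) (deriv (fun σ ↦ (γ σ : E4)) 0) (E4.basisVector 0))
    (hE5 : -Kerr.bilin M a (γ 0) (deriv (fun σ ↦ (γ σ : E4)) 0) (E4.basisVector 0) ≤ 5)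
    (hfar : ∀ t ∈ dom, 0 ≤ t → 16 * M ≤ Kerr.radius a (γ t)) : Ici (0 : ℝ) ⊆ dom := by
  have hMp := mass_pos ha
  have hopen := hmax.isOpen
  have hoc : dom.OrdConnected := hmax.2.1
  have hgeo := hmax.isGeodesicOn
  by_contra hnot
  obtain ⟨b, hb0, hb⟩ : ∃ b, 0 ≤ b ∧ b ∉ dom := by
    simpa [subset_def] using hnot
  -- `dom` is bounded above by `b`
  have hle : ∀ t ∈ dom, t ≤ b := fun t ht ↦ by
    by_contra h
    exact hb (hoc.out h0 ht ⟨hb0, (not_le.1 h).le⟩)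
  -- kinematics on `dom ∩ [0, ∞)`
  set s : Set ℝ := dom ∩ Ici 0 with hs_def
  have hsoc : s.OrdConnected := hoc.inter ordConnected_Ici
  have hsub : s ⊆ dom := inter_subset_left
  have hder : ∀ t ∈ s, HasDerivAt (fun σ ↦ (γ σ : E4)) (deriv (fun σ ↦ (γ σ : E4)) t) t :=
    fun t ht ↦ (ray_hasDerivAt hgeo (hsub ht)).1
  have hfb : ∀ t ∈ s, 0 < deriv (fun σ ↦ (γ σ : E4)) t 0 ∧
      ‖E4.spatial (deriv (fun σ ↦ (γ σ : E4)) t)‖ ≤ deriv (fun σ ↦ (γ σ : E4)) t 0 ∧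
      deriv (fun σ ↦ (γ σ : E4)) t 0 ≤ 7 := fun t ht ↦
    ray_far_bounds hM hopen hoc hgeo h0 hnull hE hE5 (hsub ht) (hfar t ht.1 ht.2)
  -- the compact set of tangent vectors
  set K : Set E4 := Metric.closedBall (γ 0 : E4) (2 * 7 * |b - 0|) ∩ Kerr.radius a ⁻¹' Ici (16 * M)
    with hK_def
  have hKc : IsCompact K :=
    (isCompact_closedBall _ _).inter_right (isClosed_Ici.preimage (Kerr.continuous_radius a))
  have hKU : K ⊆ (Kerr.region a r₁ : Set E4) := fun z hz ↦ by
    have h16 : 16 * M ≤ Kerr.radius a z := hz.2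
    show max r₁ 0 < Kerr.radius a z
    rw [max_lt_iff]
    constructor <;> linarith [rPlus_le_two_mul ha]
  haveI : CovariantDerivative.ContMDiffCovariantDerivative (Kerr.smoothMetric M a r₁).leviCivita 1 :=
    ⟨(Kerr.smoothMetric M a r₁).toPseudoRiemannianMetric.isLocallyContMDiff_leviCivita_holds 1
      (by rw [show ((1 : ℕ∞) : ℕ∞ω) + 1 = 2 by norm_num]; exact WithTop.coe_le_coe.2 le_top)
      univ isOpen_univ⟩
  have h𝒦 := isCompact_setOf_tangent (U := Kerr.region a r₁) hKc hKU (2 * 7)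
  refine not_bddAbove_of_tangentLift_mem hmax h𝒦 h0 (fun t ht ht0 ↦ ?_) ⟨b, hle⟩
  have hts : t ∈ s := ⟨ht, ht0⟩
  have h0s : (0 : ℝ) ∈ s := ⟨h0, Set.mem_Ici.2 le_rfl⟩
  refine ⟨⟨?_, ?_⟩, ?_⟩
  · have h := norm_sub_le_mul hsoc hder (fun t ht ↦ (hfb t ht).2.1) (fun t ht ↦ (hfb t ht).2.2) h0s hts
    rw [Metric.mem_closedBall, dist_eq_norm]
    refine h.trans ?_
    have : |t - 0| ≤ |b - 0| := by rw [sub_zero, sub_zero, abs_of_nonneg ht0, abs_of_nonneg hb0]; exact hle t ht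
    nlinarith [abs_nonneg (t - 0)]
  · exact hfar t ht ht0
  · have h : ‖deriv (fun σ ↦ (γ σ : E4)) t‖ ≤ 2 * 7 :=
      (norm_le_two_mul_of_spatial_le (hfb t hts).2.1).trans (by linarith [(hfb t hts).2.2])
    simpa [CollarCauchy.velocity_eq_deriv] using h

omit [Kerr.Facts] [(Kerr.smoothMetric M a r₁).HasLeviCivita] in
/-- **First hitting time.** For `f` continuous on `[0, t₁]` with `f 0 > c ≥ f t₁` there is a first
parameter `λ₁ ∈ (0, t₁]` with `f λ₁ = c`, before which `f > c` (infimum of the closed set `{f ≤ c}`,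
intermediate value theorem). [folklore] -/
theorem exists_first_hit {f : ℝ → ℝ} {t₁ c : ℝ} (ht₁ : 0 ≤ t₁) (hf : ContinuousOn f (Icc 0 t₁))
    (h0 : c < f 0) (h1 : f t₁ ≤ c) :
    ∃ l ∈ Ioc 0 t₁, f l = c ∧ ∀ t ∈ Ico 0 l, c < f t := by
  set S : Set ℝ := Icc 0 t₁ ∩ f ⁻¹' Iic c with hS
  have hSc : IsClosed S := hf.preimage_isClosed_of_isClosed isClosed_Icc isClosed_Iic
  have hSne : S.Nonempty := ⟨t₁, ⟨ht₁, le_rfl⟩, h1⟩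
  have hSbdd : BddBelow S := ⟨0, fun t ht ↦ ht.1.1⟩
  set l := sInf S with hl
  have hlS : l ∈ S := hSc.csInf_mem hSne hSbdd
  have hbefore : ∀ t ∈ Ico 0 l, c < f t := fun t ht ↦ by
    have hnot : t ∉ S := notMem_of_lt_csInf ht.2 hSbdd
    by_contra hle
    exact hnot ⟨⟨ht.1, ht.2.le.trans hlS.1.2⟩, not_lt.1 hle⟩
  have hl0 : 0 < l := by
    rcases hlS.1.1.eq_or_lt with h | h
    · exfalso
      have : f l ≤ c := hlS.2
      rw [← h] at this
      linarith
    · exact h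
  refine ⟨l, ⟨hl0, hlS.1.2⟩, ?_, hbefore⟩
  rcases (show f l ≤ c from hlS.2).eq_or_lt with h | h
  · exact h
  · exfalso
    obtain ⟨x, hx, hfx⟩ := intermediate_value_Icc' hl0.le (hf.mono (Icc_subset_Icc le_rfl hlS.1.2))
      ⟨h.le, h0.le⟩
    have hxl : x ≠ l := fun hxl ↦ by rw [hxl] at hfx; linarith
    have := hbefore x ⟨hx.1, lt_of_le_of_ne hx.2 hxl⟩
    linarith

/-- **First exit from `{r > 16M}`.** If the ray starts at `r > 16M` and reaches `r < 16M` at some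
`t₁ ∈ dom`, `t₁ ≥ 0`, there is a first parameter `l₁ > 0` with `[0, l₁] ⊆ dom`, `r(γ l₁) = 16M` and
`r ≥ 16M` on `[0, l₁]`. [folklore] -/
theorem exists_first_exit (hoc : dom.OrdConnected)
    (hgeo : IsGeodesicOn (Kerr.smoothMetric M a r₁).leviCivita γ dom) (h0 : (0 : ℝ) ∈ dom)
    (hr0 : 16 * M < Kerr.radius a (γ 0)) {t₁ : ℝ} (ht₁ : t₁ ∈ dom) (ht₁0 : 0 ≤ t₁)
    (hr₁ : Kerr.radius a (γ t₁) < 16 * M) :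
    ∃ l₁ : ℝ, 0 < l₁ ∧ Icc 0 l₁ ⊆ dom ∧ Kerr.radius a (γ l₁) = 16 * M ∧
      ∀ t ∈ Icc 0 l₁, 16 * M ≤ Kerr.radius a (γ t) := by
  have hIcc₁ : Icc 0 t₁ ⊆ dom := hoc.out h0 ht₁
  have hrcont : ContinuousOn (fun σ ↦ Kerr.radius a (γ σ)) (Icc 0 t₁) := fun t ht ↦
    ((Kerr.continuous_radius a).continuousAt.comp (ray_hasDerivAt hgeo (hIcc₁ ht)).1.continuousAt)
      |>.continuousWithinAt
  obtain ⟨l₁, ⟨hl₁0, hl₁t⟩, hrl₁, hbefore⟩ := exists_first_hit ht₁0 hrcont hr0 hr₁.le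
  refine ⟨l₁, hl₁0, fun t ht ↦ hIcc₁ ⟨ht.1, ht.2.trans hl₁t⟩, hrl₁, fun t ht ↦ ?_⟩
  rcases ht.2.eq_or_lt with h | h
  · rw [h, hrl₁]
  · exact (hbefore t ⟨ht.1, h⟩).le

/-- **Banking the sojourn.** Let the null geodesic `γ` of the chart (energy `E ∈ (0, 5]`, future
directed at `0`) start at the leaf point over `y` with `‖y‖ ≥ 21 s + 53M + |a| + 1` and stay in
`{r ≥ 16M}` on `[0, l₁] ⊆ dom`, `l₁ > 0`, with `r(γ l₁) = 16M`.  Then there is `lₑ ∈ [0, l₁]` with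
`l₁ − lₑ ≥ s` such that `γ t ∈ J⁺(ψ{r ≤ 10M})` for all `t ∈ [lₑ, l₁]`: the banking function
`f = t* − 2‖x⃗‖ + 14M` is `< 0` at `0` and `> 0` at `l₁`, vanishes at some `lₑ` (intermediate value
theorem) where the ray is in the explicit region `{x⁰ ≥ 2‖x⃗‖ − 14M, ‖x⃗‖ ≥ 10M} ⊆ J⁺(ψ{r ≤ 10M})`,
`J⁺` is hereditary along the ray, and `f(l₁) ≤ 21 (l₁ − lₑ)` while `f(l₁) ≥ ‖y‖ − 37M`.
[cite: arXiv08110354, §5.1] -/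
theorem exists_banked_interval (ha : |a| < M) (hM : 0 ≤ M) (h₁ : Kerr.rMinus M a < r₁)
    (h₂ : r₁ < Kerr.rPlus M a) (hopen : IsOpen dom) (hoc : dom.OrdConnected)
    (hgeo : IsGeodesicOn (Kerr.smoothMetric M a r₁).leviCivita γ dom) (h0 : (0 : ℝ) ∈ dom)
    (hnull : Kerr.bilin M a (γ 0) (deriv (fun σ ↦ (γ σ : E4)) 0) (deriv (fun σ ↦ (γ σ : E4)) 0) = 0)
    (hfd : 0 < deriv (fun σ ↦ (γ σ : E4)) 0 0)
    (hE : 0 < -Kerr.bilin M a (γ 0) (deriv (fun σ ↦ (γ σ : E4)) 0) (E4.basisVector 0))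
    (hE5 : -Kerr.bilin M a (γ 0) (deriv (fun σ ↦ (γ σ : E4)) 0) (E4.basisVector 0) ≤ 5)
    {y : Kerr.slice a r₁} (hγ0 : γ 0 = graph M a r₁ y) {s : ℝ} (hs : 0 < s)
    (hy : 21 * s + 53 * M + |a| + 1 ≤ ‖(y : E3)‖) {l₁ : ℝ} (hl₁0 : 0 < l₁) (hI : Icc 0 l₁ ⊆ dom)
    (hrl₁ : Kerr.radius a (γ l₁) = 16 * M) (hfarI : ∀ t ∈ Icc 0 l₁, 16 * M ≤ Kerr.radius a (γ t)) :
    ∃ lₑ ∈ Icc 0 l₁, s ≤ l₁ - lₑ ∧ ∀ t ∈ Icc lₑ l₁,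
      γ t ∈ (Kerr.smoothMetric M a r₁).causalFuture ((Kerr.timeOrientation M a r₁ hM).ofLE le_top)
        (graph M a r₁ '' {y' : Kerr.slice a r₁ | Kerr.radius a (E4.ofTimeSpace 0 (y' : E3)) ≤ 10 * M}) := by
  have hMp := mass_pos ha
  have habs : 0 ≤ |a| := abs_nonneg a
  have hs21 : 0 ≤ 21 * s := by positivity
  -- kinematics on `[0, l₁]`
  have hIoc : (Icc (0 : ℝ) l₁).OrdConnected := ordConnected_Icc
  have hder : ∀ t ∈ Icc 0 l₁, HasDerivAt (fun σ ↦ (γ σ : E4)) (deriv (fun σ ↦ (γ σ : E4)) t) t :=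
    fun t ht ↦ (ray_hasDerivAt hgeo (hI ht)).1
  have hfb : ∀ t ∈ Icc 0 l₁, 0 < deriv (fun σ ↦ (γ σ : E4)) t 0 ∧
      ‖E4.spatial (deriv (fun σ ↦ (γ σ : E4)) t)‖ ≤ deriv (fun σ ↦ (γ σ : E4)) t 0 ∧
      deriv (fun σ ↦ (γ σ : E4)) t 0 ≤ 7 := fun t ht ↦
    ray_far_bounds hM hopen hoc hgeo h0 hnull hE hE5 (hI ht) (hfarI t ht)
  have hdisp : ∀ t ∈ Icc 0 l₁, ∀ t' ∈ Icc 0 l₁, t ≤ t' →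
      ‖E4.spatial (γ t' : E4) - E4.spatial (γ t : E4)‖ ≤ (γ t' : E4) 0 - (γ t : E4) 0 :=
    fun t ht t' ht' htt' ↦
      norm_spatial_sub_le_time_sub hIoc hder (fun u hu ↦ (hfb u hu).2.1) ht ht' htt'
  have htime : ∀ t ∈ Icc 0 l₁, ∀ t' ∈ Icc 0 l₁, t ≤ t' →
      (γ t' : E4) 0 - (γ t : E4) 0 ≤ 7 * (t' - t) :=
    fun t ht t' ht' htt' ↦ time_sub_le_mul hIoc hder (fun u hu ↦ (hfb u hu).2.2) ht ht' htt'
  -- values at the start and at the exit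
  have hstart0 : (γ 0 : E4) 0 = bentHeight M a (Kerr.radius a (E4.ofTimeSpace 0 (y : E3))) := by
    rw [hγ0, coe_graph, E4.ofTimeSpace_apply_zero]
  have hstartsp : E4.spatial (γ 0 : E4) = (y : E3) := by
    rw [hγ0, coe_graph, E4.spatial_ofTimeSpace]
  have hρy : Kerr.radius a (E4.ofTimeSpace 0 (y : E3)) ≤ ‖(y : E3)‖ :=
    (Kerr.radius_le_spatialNorm a _).trans_eq (E4.spatialNorm_ofTimeSpace 0 _)
  have hT0 : 0 ≤ (γ 0 : E4) 0 := by
    rw [hstart0]; exact CollarCauchy.bentHeight_nonneg ha _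
  have hT1 : (γ 0 : E4) 0 ≤ ‖(y : E3)‖ / 2 + M := by
    rw [hstart0]
    have := CollarCauchy.bentHeight_le_half_add ha (Kerr.radius_nonneg a (E4.ofTimeSpace 0 (y : E3)))
    linarith
  have hρ1 : ‖E4.spatial (γ l₁ : E4)‖ ≤ 17 * M := by
    have h := spatialNorm_sub_le_radius a (γ l₁ : E4)
    rw [hrl₁] at h
    change ‖E4.spatial (γ l₁ : E4)‖ - |a| ≤ 16 * M at h
    linarith [ha.le]
  have h0I : (0 : ℝ) ∈ Icc 0 l₁ := ⟨le_rfl, hl₁0.le⟩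
  have hl₁I : l₁ ∈ Icc 0 l₁ := ⟨hl₁0.le, le_rfl⟩
  have hrev : ∀ t ∈ Icc 0 l₁, ‖(y : E3)‖ - ‖E4.spatial (γ t : E4)‖ ≤ (γ t : E4) 0 - (γ 0 : E4) 0 := by
    intro t ht
    have h1 := hdisp 0 h0I t ht ht.1
    rw [hstartsp] at h1
    have h2 : ‖(y : E3)‖ - ‖E4.spatial (γ t : E4)‖ ≤ ‖E4.spatial (γ t : E4) - (y : E3)‖ := by
      rw [norm_sub_rev]; exact norm_sub_norm_le _ _
    linarith
  -- the banking function
  set f : ℝ → ℝ := fun t ↦ (γ t : E4) 0 - 2 * ‖E4.spatial (γ t : E4)‖ + 14 * M with hf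
  have hfcont : ContinuousOn f (Icc 0 l₁) := by
    intro t ht
    have hc := (hder t ht).continuousAt
    have h1 : ContinuousAt (fun σ ↦ (γ σ : E4) 0) t :=
      ((EuclideanSpace.proj (0 : Fin 4) : E4 →L[ℝ] ℝ).continuous.continuousAt).comp hc
    have h2 : ContinuousAt (fun σ ↦ ‖E4.spatial (γ σ : E4)‖) t :=
      ((continuous_norm.comp E4.spatial.continuous).continuousAt).comp hc
    exact ((h1.sub (continuousAt_const.mul h2)).add continuousAt_const).continuousWithinAt
  have hf0 : f 0 < 0 := by
    have : f 0 = (γ 0 : E4) 0 - 2 * ‖(y : E3)‖ + 14 * M := by simp only [hf, hstartsp]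
    rw [this]
    linarith
  have hf1' : ‖(y : E3)‖ - 37 * M ≤ f l₁ := by
    have h := hrev l₁ hl₁I
    simp only [hf]
    linarith
  have hf1 : 0 < f l₁ := by linarith
  obtain ⟨lₑ, hlₑ, hfe⟩ : ∃ lₑ ∈ Icc 0 l₁, f lₑ = 0 :=
    intermediate_value_Icc hl₁0.le hfcont ⟨hf0.le, hf1.le⟩
  have hfe' : (γ lₑ : E4) 0 - 2 * ‖E4.spatial (γ lₑ : E4)‖ + 14 * M = 0 := hfe
  -- at `lₑ` the ray is in the explicit region
  have hρe : 10 * M ≤ ‖E4.spatial (γ lₑ : E4)‖ := by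
    have h := hrev lₑ hlₑ
    linarith
  have hJe := leaf_cone_mem_causalFuture ha hM h₁ h₂ (γ lₑ) hρe
    (by change 2 * ‖E4.spatial (γ lₑ : E4)‖ - 14 * M ≤ (γ lₑ : E4) 0; linarith)
  -- `J⁺` is hereditary along the ray on `[lₑ, l₁]`
  have hE0 : Kerr.bilin M a (γ 0) (deriv (fun σ ↦ (γ σ : E4)) 0) (E4.basisVector 0) ≠ 0 := by
    intro h; rw [h] at hE; simp at hE
  refine ⟨lₑ, hlₑ, ?_, fun t ht ↦ mem_causalFuture_of_le hM ht.1
    (ray_isFutureCausalCurveOn hM hopen hoc hgeo h0 hnull hfd hE0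
      (fun u hu ↦ hI ⟨hlₑ.1.trans hu.1, hu.2.trans ht.2⟩)) hJe⟩
  -- the length of the banked interval: `f l₁ ≤ 21 (l₁ − lₑ)`
  have h1 := htime lₑ hlₑ l₁ hl₁I hlₑ.2
  have h2 := hdisp lₑ hlₑ l₁ hl₁I hlₑ.2
  have h3 : ‖E4.spatial (γ lₑ : E4)‖ - ‖E4.spatial (γ l₁ : E4)‖ ≤
      ‖E4.spatial (γ l₁ : E4) - E4.spatial (γ lₑ : E4)‖ := by
    rw [norm_sub_rev]; exact norm_sub_norm_le _ _
  have h4 : f l₁ ≤ 21 * (l₁ - lₑ) := by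
    have : f l₁ = f l₁ - f lₑ := by rw [hfe, sub_zero]
    rw [this]
    simp only [hf]
    linarith
  linarith

end Main

end KerrLeafSojourn

open KerrLeafSojourn in
/-- **S4 `stub_kerrLeafSojourn` — sojourn completeness of the ingoing Kerr–Schild chart seen from the bent
leaf.**  For sub-extremal `(M, a)`, `0 ≤ M`, `r₋ < r₁ < r₊`, `ψ` the graph of the hard-coded height `T`
over `Kerr.slice a r₁` and `ν` a future unit normal field of it: with `R₀ = 10M`, for every `s > 0` and
`R₁ = 21 s + 53M + |a| + 1`, every normalised future null ray of `g_{M,a}` (maximal geodesic of the chart,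
`γ 0 = ψ y`, `g(γ̇(0), ν y) = −1`) from a leaf point of Kerr–Schild radius `≥ R₁` is either future complete
in the chart (`[0, ∞) ⊆ dom`) or spends affine time `≥ s` in `J⁺(ψ{r ≤ R₀})`.  Conserved Killing energy
`0 < E ≤ 5`, far bounds `0 < γ̇⁰ ≤ 7`, `|γ̇⃗| ≤ γ̇⁰` on `{r ≥ 16M}`, escape lemma, first exit from
`{r > 16M}`, and banking of the sojourn through the explicit region
`{x⁰ ≥ 2‖x⃗‖ − 14M, ‖x⃗‖ ≥ 10M} ⊆ J⁺(ψ{r ≤ 10M})` by the intermediate value theorem (module docstring).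
Dafermos–Rodnianski arXiv:0811.0354, §5.1; Christodoulou, CQG 16 (1999) A23, pp. A26–A27.
[cite: arXiv08110354, §5.1] -/
theorem stub_kerrLeafSojourn : ∀ [Kerr.Facts] (M a r₁ : ℝ) (hM : 0 ≤ M), |a| < M →
    Kerr.rMinus M a < r₁ → r₁ < Kerr.rPlus M a →
    ∀ (ψ : Kerr.slice a r₁ → Kerr.region a r₁) (ν : NormalField 𝓘(ℝ, E4) ψ),
    (∀ y : Kerr.slice a r₁, (ψ y : E4) =
        E4.ofTimeSpace (bentHeight M a (Kerr.radius a (E4.ofTimeSpace 0 (y : E3)))) (y : E3)) →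
    (Kerr.smoothMetric M a r₁).IsFutureUnitNormal 𝓘(ℝ, E3)
        ((Kerr.timeOrientation M a r₁ hM).ofLE le_top) ψ ν →
    ∀ [(Kerr.smoothMetric M a r₁).HasLeviCivita],
    ∃ R₀ : ℝ, ∀ s : ℝ, 0 < s → ∃ R₁ : ℝ, ∀ y : Kerr.slice a r₁,
      R₁ ≤ Kerr.radius a (E4.ofTimeSpace 0 (y : E3)) →
      ∀ (γ : ℝ → Kerr.region a r₁) (dom : Set ℝ),
        (Kerr.smoothMetric M a r₁).IsNormalisedNullRayFrom
            ((Kerr.timeOrientation M a r₁ hM).ofLE le_top) ψ ν y γ dom →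
        Set.Ici (0 : ℝ) ⊆ dom ∨
          ENNReal.ofReal s ≤ sojournTime γ dom
            ((Kerr.smoothMetric M a r₁).causalFuture ((Kerr.timeOrientation M a r₁ hM).ofLE le_top)
              (ψ '' {y' : Kerr.slice a r₁ | Kerr.radius a (E4.ofTimeSpace 0 (y' : E3)) ≤ R₀})) := by
  intro _ M a r₁ hM ha h₁ h₂ ψ ν hψ hν _
  obtain rfl := psi_eq_graph rfl hψ
  have hMp := mass_pos ha
  refine ⟨10 * M, fun s hs ↦ ⟨21 * s + 53 * M + |a| + 1, fun y hy γ dom hray ↦ ?_⟩⟩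
  have hmax := hray.isMaximalGeodesicOn
  have hoc : dom.OrdConnected := hmax.2.1
  have h0 : (0 : ℝ) ∈ dom := hray.zero_mem
  have hγ0 : γ 0 = graph M a r₁ y := hray.apply_zero
  have hv0 : (velocity 𝓘(ℝ, E4) γ 0 : E4) = deriv (fun σ ↦ (γ σ : E4)) 0 :=
    CollarCauchy.velocity_eq_deriv γ 0
  have hnull : Kerr.bilin M a (γ 0) (deriv (fun σ ↦ (γ σ : E4)) 0) (deriv (fun σ ↦ (γ σ : E4)) 0) = 0 := by
    have h : Kerr.bilin M a (γ 0) (velocity 𝓘(ℝ, E4) γ 0) (velocity 𝓘(ℝ, E4) γ 0) = 0 :=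
      hray.isNull_velocity.1
    rwa [hv0] at h
  have hfd : 0 < deriv (fun σ ↦ (γ σ : E4)) 0 0 := by
    have h : Kerr.bilin M a (γ 0) (Kerr.timeVector M a (γ 0)) (velocity 𝓘(ℝ, E4) γ 0) < 0 :=
      hray.isFutureDirected_velocity.2
    rw [Kerr.bilin_timeVector (Kerr.radius_pos_of_mem_region (γ 0).2), hv0] at h
    linarith
  have hnorm : Kerr.bilin M a (graph M a r₁ y) (deriv (fun σ ↦ (γ σ : E4)) 0) (ν y) = -1 := by
    have h : Kerr.bilin M a (graph M a r₁ y) (velocity 𝓘(ℝ, E4) γ 0) (ν y) = -1 :=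
      hray.val_velocity_normal
    rwa [hv0] at h
  -- sizes at the start and the energy
  have hρy : Kerr.radius a (E4.ofTimeSpace 0 (y : E3)) ≤ ‖(y : E3)‖ :=
    (Kerr.radius_le_spatialNorm a _).trans_eq (E4.spatialNorm_ofTimeSpace 0 _)
  have hy53 : 21 * s + 53 * M + |a| + 1 ≤ ‖(y : E3)‖ := hy.trans hρy
  have hs21 : 0 ≤ 21 * s := by positivity
  have hy16 : 16 * M + |a| + 1 ≤ ‖(y : E3)‖ := by linarith
  obtain ⟨hE, hE5⟩ := energy_pos_le_five ha hM hν y hy16 (by rw [← hγ0]; exact hnull) hfd hnorm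
  rw [← hγ0] at hE hE5
  by_cases hdom : Ici (0 : ℝ) ⊆ dom
  · exact Or.inl hdom
  right
  -- an exit parameter from `{r ≥ 16M}`, and the first one
  obtain ⟨t₁, ht₁, ht₁0, hr₁⟩ : ∃ t₁ ∈ dom, 0 ≤ t₁ ∧ Kerr.radius a (γ t₁) < 16 * M := by
    by_contra hcon
    push Not at hcon
    exact hdom (Ici_subset_of_far ha hM h₂ hmax h0 hnull hE hE5 fun t ht ht0 ↦ hcon t ht ht0)
  have hr0 : 16 * M < Kerr.radius a (γ 0) := by
    rw [hγ0, coe_graph, Kerr.radius_ofTimeSpace]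
    linarith [abs_nonneg a]
  obtain ⟨l₁, hl₁0, hI, hrl₁, hfarI⟩ :=
    exists_first_exit hoc hmax.isGeodesicOn h0 hr0 ht₁ ht₁0 hr₁
  obtain ⟨lₑ, hlₑ, hlen, hJ⟩ := exists_banked_interval ha hM h₁ h₂ hmax.isOpen hoc hmax.isGeodesicOn
    h0 hnull hfd hE hE5 hγ0 hs hy53 hl₁0 hI hrl₁ hfarI
  have hsub : Icc lₑ l₁ ⊆ {t ∈ dom | 0 ≤ t ∧ γ t ∈ (Kerr.smoothMetric M a r₁).causalFuture
      ((Kerr.timeOrientation M a r₁ hM).ofLE le_top)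
      (graph M a r₁ '' {y' : Kerr.slice a r₁ | Kerr.radius a (E4.ofTimeSpace 0 (y' : E3)) ≤ 10 * M})} :=
    fun t ht ↦ ⟨hI ⟨hlₑ.1.trans ht.1, ht.2⟩, hlₑ.1.trans ht.1, hJ t ht⟩
  calc ENNReal.ofReal s ≤ ENNReal.ofReal (l₁ - lₑ) := ENNReal.ofReal_le_ofReal hlen
    _ = volume (Icc lₑ l₁) := Real.volume_Icc.symm
    _ ≤ _ := measure_mono hsub

end Summit.FinalStateConjecture.FinalStateConjecture.Theorems.SwallowTheDatum.KerrShieldedSettles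

end
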